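import Mathlib.NumberTheory.Padics.RingHoms
import Mathlib.NumberTheory.Padics.PadicVal.Basic
import Mathlib.Analysis.Normed.Group.Ultra
import Mathlib.Analysis.SpecialFunctions.Pow.Real
import HarnessLib

/-!
# The `p`-adic Nesterenko criterion over `ℚ` — the box principle (Chantanasiri 2012, §2.2)

Topic `Literature/NumberTheory/DiophantineApproximation`. Everything in this file is PROVED; it is the
first of three files discharging the named fact
`Literature.NumberTheory.DiophantineApproximation.sprang2020_theorem14_rat` (Sprang 2020, Thm 1.4 =
Chantanasiri's `p`-adic Nesterenko criterion, case `K = ℚ`; statement file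
`PAdicNesterenkoCriterion.lean`, untouched).

Chantanasiri proves the `p`-adic criterion for `K = ℚ` in [Chantanasiri2012, §2.2, Théorème 2.4]
("un analogue ultramétrique du théorème 1.1"), where "le théorème de Minkowski va être remplacé ici
par le principe des tiroirs" [Chantanasiri2012, p. 96]. This file contains the two arithmetic inputs
of that proof:

* `one_le_abs_mul_padicNorm` — the product formula over `ℚ` in the form used on p. 99: a non-zero
  integer `N` has `|N| ≥ |N|_p^{-1}`, i.e. `1 ≤ |N| · ‖N‖_p`;
* `exists_unit_approx` — the `p`-adic box principle [Chantanasiri2012, Lemme 2.5 / Corollaire 2.1]: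
  for `ξ₀ = 1, ξ₁, …, ξ_m ∈ ℤ_p` and `j ≥ 1`, pigeonhole on the `(p^{jm}+1)^{m+1}` integer points
  `0 ≤ x_t ≤ p^{jm}` against the `p^{(m+1)jm}` values of `(x₀ξ_t − x_t mod p^{(m+1)j})_{1≤t≤m}`
  (`PadicInt.toZModPow`) gives integers `(a₀; a_t) ≠ 0` with `|a_t| ≤ p^{jm}`,
  `‖a₀ξ_t − a_t‖_p ≤ p^{−(m+1)j}`, and `a₀ ≠ 0`. We add one normalisation that is not in the
  source (it replaces Chantanasiri's bookkeeping of `|x₀|_p` on p. 98): dividing the vector by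
  `p^{v_p(a₀)}` (which divides every `a_t` by the ultrametric inequality) yields a `p`-adic UNIT `a₀`
  at a level `k = (m+1)j − v_p(a₀) ≥ j`, with `|a_t|^{m+1} ≤ p^{km}` and `‖a₀ξ_t − a_t‖_p ≤ p^{−k}`.

The transference step (Théorème 2.4 itself, in the `o(1)`-form of Sprang's Theorem 1.4) is
`PAdicNesterenkoCriterionCore.lean`; the reduction to a basis of `ℚ + ℚθ₁ + ⋯ + ℚθ_s` and the
discharge are `PAdicNesterenkoCriterionProofs.lean`. Cell pub-zeta5 (HONEST FRAMING): a criterion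
made a theorem; nothing here concerns `ζ(5)`.

## References

* A. Chantanasiri, *Généralisation des critères pour l'indépendance linéaire de Nesterenko, Amoroso,
  Colmez, Fischler et Zudilin*, Ann. Math. Blaise Pascal 19 (2012) 75–105, §2.2 (Lemme 2.5,
  Corollaire 2.1, Lemme 2.7, Théorème 2.4, pp. 95–99). [Chantanasiri2012] (held:
  `paper:doi-10-5802-ambp-305`, read on the page.)
* J. Sprang, *Linear independence result for p-adic L-values*, Duke Math. J. 169 (2020), Thm 1.4 and
  §9. [Sprang2020]
-/

noncomputable section

open Finset

namespace Literature.NumberTheory.DiophantineApproximation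

namespace PAdicNesterenkoCriterion

variable {p : ℕ} [Fact p.Prime]

/-- **Product formula over `ℚ`** in the form "comme `L_k(x)` est un entier non nul, on a
`|L_k(x)| ≥ |L_k(x)|_p^{-1}`": a non-zero integer `N` satisfies `1 ≤ |N| · ‖N‖_p` (because
`p^{v_p(N)} ∣ N`). [cite: Chantanasiri2012, proof of Thm 2.4 (p. 99)] -/
theorem one_le_abs_mul_padicNorm {N : ℤ} (hN : N ≠ 0) :
    (1 : ℝ) ≤ |(N : ℝ)| * ‖(N : ℚ_[p])‖ := by
  have hp : (1 : ℝ) < p := by exact_mod_cast (Fact.out : p.Prime).one_lt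
  set v := padicValInt p N with hv
  have hdvd : (p : ℤ) ^ v ∣ N := padicValInt_dvd N
  have hnorm : ‖(N : ℚ_[p])‖ = (p : ℝ) ^ (-(v : ℤ)) := by
    have h := Padic.norm_eq_zpow_neg_valuation (p := p) (x := (N : ℚ_[p]))
      (by exact_mod_cast hN)
    rw [h]
    congr 2
    rw [show (N : ℚ_[p]) = ((N : ℚ) : ℚ_[p]) by norm_cast, Padic.valuation_ratCast,
      padicValRat.of_int]
  have hle : ((p : ℤ) ^ v : ℤ) ≤ |N| := Int.le_of_dvd (abs_pos.mpr hN) ((dvd_abs _ _).mpr hdvd)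
  have hle' : (p : ℝ) ^ v ≤ |(N : ℝ)| := by
    rw [← Int.cast_abs]; exact_mod_cast hle
  rw [hnorm, zpow_neg, zpow_natCast]
  have hpv : (0 : ℝ) < (p : ℝ) ^ v := by positivity
  rw [le_mul_inv_iff₀ hpv, one_mul]
  exact hle'

/-- **The `p`-adic box principle, with a unit denominator** ("le théorème de Minkowski va être
remplacé ici par le principe des tiroirs"). For `ξ₀ = 1, ξ₁, …, ξ_m ∈ ℤ_p` and `j ≥ 1` there are a
level `k ≥ j` and integers `a₀, …, a_m` with `a₀` a `p`-adic UNIT, `|a_t|^{m+1} ≤ p^{km}` and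
`‖a₀ ξ_t − a_t‖_p ≤ p^{−k}` for every `t`: pigeonhole on the `(p^{jm}+1)^{m+1}` integer points of the
box `0 ≤ x_t ≤ p^{jm}` against the `p^{(m+1)jm}` residue classes of `(x₀ξ_t − x_t)_{t≥1}` modulo
`p^{(m+1)j}` (the source's Lemme 2.5 with `r = t = m`, `s = (m+1)j`), `a₀ ≠ 0` as on p. 98, then — our
normalisation, not in the source — division of the whole vector by `p^{v_p(a₀)}`.
[cite: Chantanasiri2012, Lemme 2.5 and Corollaire 2.1 (pp. 96–97); proof of Thm 2.4 (p. 98)] -/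
theorem exists_unit_approx (m : ℕ) (ξ : Fin (m + 1) → ℚ_[p]) (hξ0 : ξ 0 = 1)
    (hξ : ∀ t, ‖ξ t‖ ≤ 1) {j : ℕ} (hj : 1 ≤ j) :
    ∃ (k : ℕ) (a : Fin (m + 1) → ℤ), j ≤ k ∧ ‖(a 0 : ℚ_[p])‖ = 1 ∧
      (∀ t, |a t| ^ (m + 1) ≤ (p : ℤ) ^ (k * m)) ∧
      ∀ t, ‖(a 0 : ℚ_[p]) * ξ t - a t‖ ≤ (p : ℝ) ^ (-(k : ℤ)) := by
  classical
  have hp : p.Prime := Fact.out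
  have hp2 : 2 ≤ p := hp.two_le
  have hpR : (1 : ℝ) < p := by exact_mod_cast hp.one_lt
  -- Step 1: raw pigeonhole at level `k₀ = (m+1) j` with box side `X = p^(j m)`
  set k₀ := (m + 1) * j with hk₀
  set X := p ^ (j * m) with hX
  let ξI : Fin (m + 1) → ℤ_[p] := fun t => ⟨ξ t, hξ t⟩
  let F : (Fin (m + 1) → Fin (X + 1)) → Fin m → ZMod (p ^ k₀) := fun x i =>
    PadicInt.toZModPow k₀ (((x 0 : ℕ) : ℤ_[p]) * ξI i.succ - ((x i.succ : ℕ) : ℤ_[p]))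
  have hcard : Fintype.card (Fin m → ZMod (p ^ k₀)) <
      Fintype.card (Fin (m + 1) → Fin (X + 1)) := by
    simp only [Fintype.card_fun, Fintype.card_fin, ZMod.card]
    calc (p ^ k₀) ^ m = (p ^ (j * m)) ^ (m + 1) := by rw [hk₀, ← pow_mul, ← pow_mul]; ring_nf
      _ < (X + 1) ^ (m + 1) := by
        rw [hX]
        exact Nat.pow_lt_pow_left (Nat.lt_succ_self _) (Nat.succ_ne_zero m)
  obtain ⟨x, y, hne, hxy⟩ := Fintype.exists_ne_map_eq_of_card_lt F hcard
  -- the raw solution `a` (with `a 0` in the role of the denominator)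
  set a : Fin (m + 1) → ℤ := fun t => ((x t : ℕ) : ℤ) - ((y t : ℕ) : ℤ) with ha
  have habs : ∀ t, |a t| ≤ (X : ℤ) := by
    intro t
    have hx := Nat.lt_succ_iff.mp (x t).isLt
    have hy := Nat.lt_succ_iff.mp (y t).isLt
    rw [abs_le]; constructor <;> simp only [ha] <;> omega
  have hcong : ∀ t, ‖(a 0 : ℚ_[p]) * ξ t - a t‖ ≤ (p : ℝ) ^ (-(k₀ : ℤ)) := by
    intro t
    refine Fin.cases ?_ (fun i => ?_) t
    · rw [hξ0, mul_one, sub_self, norm_zero]; positivity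
    · have h := congrFun hxy i
      simp only [F] at h
      rw [← sub_eq_zero, ← map_sub, ← RingHom.mem_ker, PadicInt.ker_toZModPow,
        ← PadicInt.norm_le_pow_iff_mem_span_pow, PadicInt.norm_def] at h
      convert h using 2
      simp only [ha, PadicInt.coe_sub, PadicInt.coe_mul, PadicInt.coe_natCast, Int.cast_sub,
        Int.cast_natCast, ξI]
      ring
  -- `a 0 ≠ 0`
  have hX_lt : (X : ℤ) < (p : ℤ) ^ k₀ := by
    rw [hX, hk₀]
    exact_mod_cast Nat.pow_lt_pow_right hp.one_lt (by nlinarith)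
  have hdvd_of_norm : ∀ (z : ℤ) (n : ℕ), ‖(z : ℚ_[p])‖ ≤ (p : ℝ) ^ (-(n : ℤ)) → (p : ℤ) ^ n ∣ z :=
    fun z n h => (Padic.norm_int_le_pow_iff_dvd z n).mp h
  have ha0 : a 0 ≠ 0 := by
    intro h0
    obtain ⟨t, ht⟩ := Function.ne_iff.mp hne
    have hat : a t ≠ 0 := by
      simp only [ha]
      have : (x t : ℕ) ≠ (y t : ℕ) := fun h => ht (Fin.ext h)
      omega
    have ht0 : t ≠ 0 := by rintro rfl; exact hat h0
    have hnorm : ‖(a t : ℚ_[p])‖ ≤ (p : ℝ) ^ (-(k₀ : ℤ)) := by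
      have := hcong t
      rwa [h0, Int.cast_zero, zero_mul, zero_sub, norm_neg] at this
    have hdvd := hdvd_of_norm _ _ hnorm
    have hle : (p : ℤ) ^ k₀ ≤ |a t| :=
      Int.le_of_dvd (abs_pos.mpr hat) ((dvd_abs _ _).mpr hdvd)
    linarith [habs t]
  -- Step 2: divide by `p^v`, `v = v_p(a 0)`
  set v := padicValInt p (a 0) with hv
  have hpv : (p : ℤ) ^ v ∣ a 0 := padicValInt_dvd (a 0)
  have hv_le : v ≤ j * m := by
    have h1 : (p : ℤ) ^ v ≤ |a 0| := Int.le_of_dvd (abs_pos.mpr ha0) ((dvd_abs _ _).mpr hpv)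
    have h2 : (p : ℤ) ^ v ≤ (p : ℤ) ^ (j * m) := by rw [hX] at habs; exact_mod_cast h1.trans (habs 0)
    exact (pow_le_pow_iff_right₀ (by exact_mod_cast hp.one_lt : (1 : ℤ) < p)).mp h2
  have hv_le_k₀ : v ≤ k₀ := by rw [hk₀]; nlinarith
  have hnorm0 : ‖(a 0 : ℚ_[p])‖ ≤ (p : ℝ) ^ (-(v : ℤ)) :=
    (Padic.norm_int_le_pow_iff_dvd (a 0) v).mpr hpv
  have hdvd_all : ∀ t, (p : ℤ) ^ v ∣ a t := by
    intro t
    apply hdvd_of_norm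
    have h1 : ‖(a 0 : ℚ_[p]) * ξ t‖ ≤ (p : ℝ) ^ (-(v : ℤ)) := by
      rw [norm_mul]
      calc ‖(a 0 : ℚ_[p])‖ * ‖ξ t‖ ≤ (p : ℝ) ^ (-(v : ℤ)) * 1 :=
            mul_le_mul hnorm0 (hξ t) (norm_nonneg _) (by positivity)
        _ = _ := mul_one _
    have h2 : ‖(a 0 : ℚ_[p]) * ξ t - a t‖ ≤ (p : ℝ) ^ (-(v : ℤ)) :=
      (hcong t).trans (zpow_le_zpow_right₀ hpR.le (by omega))
    have h3 : (a t : ℚ_[p]) = (a 0 : ℚ_[p]) * ξ t - ((a 0 : ℚ_[p]) * ξ t - a t) := by ring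
    rw [h3]
    calc ‖(a 0 : ℚ_[p]) * ξ t - ((a 0 : ℚ_[p]) * ξ t - a t)‖
        ≤ max ‖(a 0 : ℚ_[p]) * ξ t‖ ‖(a 0 : ℚ_[p]) * ξ t - a t‖ := by
          rw [sub_eq_add_neg]
          refine (IsUltrametricDist.norm_add_le_max _ _).trans ?_
          rw [norm_neg]
      _ ≤ _ := max_le h1 h2
  -- the divided solution
  obtain ⟨b, hb⟩ : ∃ b : Fin (m + 1) → ℤ, ∀ t, a t = (p : ℤ) ^ v * b t :=
    ⟨fun t => (hdvd_all t).choose, fun t => (hdvd_all t).choose_spec⟩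
  have hpvpos : (0 : ℤ) < (p : ℤ) ^ v := by positivity
  have hk₀' : k₀ = j * m + j := by rw [hk₀]; ring
  have hbR : ∀ t, (a t : ℚ_[p]) = (p : ℚ_[p]) ^ v * (b t : ℚ_[p]) := fun t => by
    rw [hb t]; push_cast; ring
  refine ⟨k₀ - v, b, ?_, ?_, ?_, ?_⟩
  · -- `j ≤ k₀ - v`
    omega
  · -- `b 0` is a unit
    have hb0 : b 0 ≠ 0 := by intro h; apply ha0; rw [hb 0, h, mul_zero]
    have hndvd : ¬ (p : ℤ) ∣ b 0 := by
      intro hd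
      have h1 : (p : ℤ) ^ (v + 1) ∣ a 0 := by
        rw [hb 0, pow_succ]; exact mul_dvd_mul_left _ hd
      rcases (padicValInt_dvd_iff (v + 1) (a 0)).mp h1 with h | h
      · exact ha0 h
      · rw [← hv] at h; omega
    have h1 := Padic.norm_int_le_one (p := p) (b 0)
    have h2 : ¬ ‖(b 0 : ℚ_[p])‖ < 1 := by rw [Padic.norm_intCast_lt_one_iff]; exact hndvd
    exact le_antisymm h1 (not_lt.mp h2)
  · -- sizes: `|b t|^(m+1) ≤ p^((k₀ - v) m)`
    intro t
    have h1 : |b t| ≤ (p : ℤ) ^ (j * m - v) := by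
      have h2 : (p : ℤ) ^ v * |b t| ≤ (p : ℤ) ^ v * (p : ℤ) ^ (j * m - v) := by
        rw [← pow_add, Nat.add_sub_cancel' hv_le, ← abs_of_pos hpvpos, ← abs_mul, ← hb t]
        have := habs t; rw [hX] at this; exact_mod_cast this
      exact le_of_mul_le_mul_left h2 hpvpos
    have h3 : |b t| ^ (m + 1) ≤ ((p : ℤ) ^ (j * m - v)) ^ (m + 1) :=
      pow_le_pow_left₀ (abs_nonneg _) h1 _
    refine h3.trans ?_
    rw [← pow_mul]
    refine pow_le_pow_right₀ (by exact_mod_cast hp.one_lt.le) ?_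
    -- `(j m - v)(m+1) ≤ ((m+1) j - v) m`
    obtain ⟨A, hA⟩ : ∃ A, j * m = A + v := ⟨j * m - v, by omega⟩
    have hA1 : j * m - v = A := by omega
    have hA2 : k₀ - v = A + j := by omega
    rw [hA1, hA2]
    nlinarith
  · -- congruences at level `k₀ - v`
    intro t
    have h1 : (a 0 : ℚ_[p]) * ξ t - a t = (p : ℚ_[p]) ^ v * ((b 0 : ℚ_[p]) * ξ t - b t) := by
      rw [hbR 0, hbR t]; ring
    have h2 := hcong t
    rw [h1, norm_mul, Padic.norm_p_pow] at h2
    have h3 : (0 : ℝ) < (p : ℝ) ^ (-(v : ℤ)) := by positivity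
    rw [mul_comm, ← le_div_iff₀ h3, ← zpow_sub₀ (by positivity)] at h2
    have h4 : (-((k₀ - v : ℕ) : ℤ)) = -(k₀ : ℤ) - -(v : ℤ) := by rw [Nat.cast_sub hv_le_k₀]; ring
    rw [h4]; exact h2

end PAdicNesterenkoCriterion

end Literature.NumberTheory.DiophantineApproximation
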